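import Summits.QuantumFields.YangMills.Theorems.UnitScaleTiltProp7OneFormAgmonExp
import HarnessLib

/-!
# Route `UnitScaleTilt`, crux K1 «MinimiserStabilityRegPr» (stmt-QuantumFields-19200), EX face S45 — (L3′b), ONE-FORM STOREY, FILE O4a «DECAY LETTERS»:
# **THE THREE BOOKKEEPING ROWS THE POINTWISE-DECAY EDITION (O4) CONSUMES** — (i) the weighted-sup FIXPOINT (`g ≤ A + θ·sup g`, `θ < 1` ⟹ `sup g ≤ A∕(1 − θ)`: how the LOCAL
# `O(ε₀)` stencil part of `Δ_a` is absorbed in a weighted sup norm), (ii) the BLOCK PARTITION of a weighted bond sum, (iii) `Σ_p c₀‖u p‖²∕W p ≤ Σ_y D_y²∕m_y` from per-block `L²`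
# bounds `‖𝟙_{B_y}u‖ ≤ D_y` (A4 ✓`blockDecay_oneForm_of_letters`) and per-block weight floors `m_y ≤ W` — the `E_W` letter of the decay engine (cst-p1 g35's (O3d), V3's bond twin)

Cell `ym3-torus` (HUMAN RULING D-0037; rung R3 = SU(2) YM₃ on T³ — NOT d = 4, NOT infinite volume, NOT a mass gap, NOT Clay).  Chair seat ★`ym-ust-19200-p1` g26, own pen (O4 prep).
THEOREMS ONLY (0 `def`, 0 `sorry`, default heartbeats); `--supports stmt-QuantumFields-19200 --as helper`; count-neutral.

WHAT IS PROVED (ns `Summit.QuantumFields.YangMills.Theorems.Prop7OneFormDecayLetters`).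
* §1 ★ `ciSup_le_div_of_forall_le_add_mul` — finite nonempty `ι`, `g : ι → ℝ`, `θ < 1`, `∀ x, g x ≤ A + θ·⨆ g` ⟹ `⨆ g ≤ A∕(1−θ)` (the rearrangement of lit ✓`norm_le_of_kato_bootstrap_linf`, abstract).
* §2 `sum_bond_eq_sum_blocks` — `Σ_{p : Bond} F p = Σ_{y} Σ_{p : B(p₋) = y} F p` (blocks `B = iterBlockOf (K−n)` of the source, read through `bondEquiv`).
* §3 ★★ `sum_normSq_div_weight_le_of_blocks` — for `v : BondL2K`, a bond weight `W > 0` with block floors `0 < m_y ≤ W p` (`B(p₋) = y`) and per-block bounds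
  `‖toL2(𝟙_{B(·₋)=y}·toL2⁻¹v)‖ ≤ D_y`: `Σ_p c₀‖v p‖²∕W p ≤ Σ_y D_y²∕m_y` — the `E_W²` letter of the weighted Kato bootstrap from A4's block decay and the weight's block growth.
HONEST SCOPE.  Bookkeeping; nothing of the ten EX rows, `hT`, (3.42)∕(3.46) for print's operators, EX or the crux is proved here.

References: T. Bałaban, CMP **99** (1985) 389–434 [Balaban1985BackgroundPropagators] (Thm 3.1 (3.42)∕(3.46) pp.397–398, (3.11) p.392); J. Dodziuk, V. Mathai, Contemp. Math. **398** (2006)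
[DodziukMathai2006] (§1).
-/

set_option autoImplicit false

noncomputable section

open scoped Matrix.Norms.L2Operator BigOperators InnerProductSpace ComplexConjugate

namespace Summit.QuantumFields.YangMills.Theorems.Prop7OneFormDecayLetters

open Literature.MathematicalPhysics.QuantumFieldTheory.Balaban1983to89
open Literature.MathematicalPhysics.QuantumFieldTheory.Balaban1983to89.T3ContinuumYM3Torus
open B4Sect5Torus (TSite)
open B9SectCLatticeCarrier (Bond)
open B9Eq311L2Pairing (WL2)
open B11Eq103H1Complex (BondL2K)
open B5Eq118OneStroke (iterBlockOf)
open Summit.QuantumFields.YangMills.Theorems.Prop7SectET3Transport (periodsT3 bondEquiv)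
open Summit.QuantumFields.YangMills.Theorems.Prop7SectET3HilbertLetters (W₂ toL2 toL2_symm_apply)
open Summit.QuantumFields.YangMills.Theorems.Prop7LaplaceAFlatLetters (norm_sq_toL2)
open Summit.QuantumFields.YangMills.Theorems.Prop7RieszTauFrobNorm (norm_sq_frobEquiv_symm)

/-! ## §1 The weighted-sup fixpoint -/

/-- ★ **THE FIXPOINT REARRANGEMENT**: on a finite nonempty index type, if `g x ≤ A + θ·⨆_y g y` for every `x` with `θ < 1`, then `⨆_y g y ≤ A∕(1 − θ)` — the way an `O(ε₀)` local
perturbation is absorbed in a (weighted) sup norm (lit ✓`norm_le_of_kato_bootstrap_linf`'s last step, abstract). [cite: DodziukMathai2006, Lemma 1.1 §1] -/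
theorem ciSup_le_div_of_forall_le_add_mul {ι : Type*} [Fintype ι] [Nonempty ι] (g : ι → ℝ) {A θ : ℝ} (hθ : θ < 1)
    (h : ∀ x, g x ≤ A + θ * ⨆ y, g y) : (⨆ y, g y) ≤ A / (1 - θ) := by
  have hbdd : BddAbove (Set.range g) := (Set.finite_range _).bddAbove
  have hS : (⨆ y, g y) ≤ A + θ * ⨆ y, g y := ciSup_le h
  rw [le_div_iff₀ (by linarith)]
  nlinarith [hS, hbdd]

/-! ## §2 The block partition of a bond sum -/

variable {F : T3Family} {n K : ℕ} {c₀ : ℝ}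

/-- **BLOCK PARTITION**: `Σ_{p : Bond} Φ p = Σ_y Σ_{p : B((bondEquiv⁻¹p)₋) = y} Φ p`, blocks `B = iterBlockOf (K − n)`. [folklore] -/
theorem sum_bond_eq_sum_blocks {M : Type*} [AddCommMonoid M] (Φ : Bond 3 (periodsT3 F K) → M) :
    ∑ p : Bond 3 (periodsT3 F K), Φ p
      = ∑ y : Site (F.P K) (K - n), ∑ p ∈ Finset.univ.filter (fun p : Bond 3 (periodsT3 F K) => iterBlockOf (K - n) ((bondEquiv F K).symm p).src = y), Φ p := by
  classical
  rw [← Finset.sum_fiberwise_of_maps_to (g := fun p : Bond 3 (periodsT3 F K) => iterBlockOf (K - n) ((bondEquiv F K).symm p).src) (t := Finset.univ)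
    (fun p _ => Finset.mem_univ _)]

/-! ## §3 The `E_W` letter from per-block bounds and block weight floors -/

/-- ★★ **`Σ_p c₀‖v p‖²∕W p ≤ Σ_y D_y²∕m_y`** for a bond weight `W` with block floors `0 < m_y ≤ W p` whenever `B(p₋) = y`, and per-block `L²` bounds
`‖toL2(b ↦ if B(b₋) = y then toL2⁻¹v b else 0)‖ ≤ D_y` (the conclusion shape of A4 ✓`blockDecay_oneForm_of_letters` at `S := {B(·₋) = y}`) — the `E_W²` letter of the weighted
Kato bootstrap on bonds. [cite: Balaban1985BackgroundPropagators, Thm 3.1 (3.42)∕(3.46) pp.397–398, (3.11) p.392] -/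
theorem sum_normSq_div_weight_le_of_blocks [Fact (0 < c₀)] (v : BondL2K ℂ 3 (periodsT3 F K) c₀ W₂) (W : Bond 3 (periodsT3 F K) → ℝ)
    (m D : Site (F.P K) (K - n) → ℝ) (hm : ∀ y, 0 < m y)
    (hmW : ∀ p : Bond 3 (periodsT3 F K), m (iterBlockOf (K - n) ((bondEquiv F K).symm p).src) ≤ W p)
    (hD : ∀ y, ‖toL2 F K c₀ (fun b => if iterBlockOf (K - n) b.src = y then (toL2 F K c₀).symm v b else 0)‖ ≤ D y) :
    ∑ p : Bond 3 (periodsT3 F K), c₀ * ‖WL2.equiv ℂ _ W₂ v p‖ ^ 2 / W p ≤ ∑ y : Site (F.P K) (K - n), D y ^ 2 / m y := by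
  classical
  have hc₀ : 0 < c₀ := Fact.out
  rw [sum_bond_eq_sum_blocks (n := n)]
  refine Finset.sum_le_sum fun y _ => ?_
  -- on the block `y`: `1∕W ≤ 1∕m_y`, and the block `L²` mass is `≤ D_y²`
  have hblock : ∑ p ∈ Finset.univ.filter (fun p : Bond 3 (periodsT3 F K) => iterBlockOf (K - n) ((bondEquiv F K).symm p).src = y), c₀ * ‖WL2.equiv ℂ _ W₂ v p‖ ^ 2
      = ‖toL2 F K c₀ (fun b => if iterBlockOf (K - n) b.src = y then (toL2 F K c₀).symm v b else 0)‖ ^ 2 := by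
    rw [norm_sq_toL2, Finset.mul_sum, Finset.sum_filter, ← (bondEquiv F K).symm.sum_comp]
    refine Finset.sum_congr rfl fun p _ => ?_
    by_cases hp : iterBlockOf (K - n) ((bondEquiv F K).symm p).src = y
    · rw [if_pos hp, if_pos hp, toL2_symm_apply, Equiv.apply_symm_apply, ← norm_sq_frobEquiv_symm, LinearEquiv.symm_apply_apply]
    · rw [if_neg hp, if_neg hp]
      simp
  have hstep : ∀ p ∈ Finset.univ.filter (fun p : Bond 3 (periodsT3 F K) => iterBlockOf (K - n) ((bondEquiv F K).symm p).src = y),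
      c₀ * ‖WL2.equiv ℂ _ W₂ v p‖ ^ 2 / W p ≤ c₀ * ‖WL2.equiv ℂ _ W₂ v p‖ ^ 2 / m y := by
    intro p hp
    rw [Finset.mem_filter] at hp
    have hmp : m y ≤ W p := by rw [← hp.2]; exact hmW p
    exact div_le_div_of_nonneg_left (by positivity) (hm y) hmp
  calc ∑ p ∈ Finset.univ.filter (fun p : Bond 3 (periodsT3 F K) => iterBlockOf (K - n) ((bondEquiv F K).symm p).src = y), c₀ * ‖WL2.equiv ℂ _ W₂ v p‖ ^ 2 / W p
      ≤ ∑ p ∈ Finset.univ.filter (fun p : Bond 3 (periodsT3 F K) => iterBlockOf (K - n) ((bondEquiv F K).symm p).src = y), c₀ * ‖WL2.equiv ℂ _ W₂ v p‖ ^ 2 / m y :=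
        Finset.sum_le_sum hstep
    _ = (∑ p ∈ Finset.univ.filter (fun p : Bond 3 (periodsT3 F K) => iterBlockOf (K - n) ((bondEquiv F K).symm p).src = y), c₀ * ‖WL2.equiv ℂ _ W₂ v p‖ ^ 2) / m y := by
        rw [Finset.sum_div]
    _ ≤ D y ^ 2 / m y := by
        rw [hblock]
        exact div_le_div_of_nonneg_right (pow_le_pow_left₀ (norm_nonneg _) (hD y) 2) (hm y).le

end Summit.QuantumFields.YangMills.Theorems.Prop7OneFormDecayLetters

end
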